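import Summits.QuantumFields.BalabanUV.T4Continuum.Support.NE9HoloFamilyVacuumSubtracted
import Summits.QuantumFields.BalabanUV.T4Continuum.Support.NE9FutureProfileEndOfRecordSP

/-!
# NE9HoloFamilyVacuumSubtractedSP — the owner's RE-DOCK of route R4's record-shape ENDs (D4 ∕ D6) at the ♯-END OF RECORD:
# `NE9 ∧ FadingMemory` at the Schwarz–Pick rate `θ` with prefactor `1∕(1−θ²)` (was Earle–Hamilton `2θ∕(1+θ)`, `2∕(1−θ)`),
# hypotheses byte-identical

Cell `pub-balaban`, T4-DAG §6 NE9; BINDER row NE9 OWNER lineage `b2b-balaban-t4-ne9-p1` gen 61, CRUX PROVER NE9 (ruling e34b3e0c (2));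
route R4 ∕ R4♯ of `t4/ROUTES-NE9.md` v7 (rank 1).  This is item (β) of the owner's g60 HANDOFF («when leaf-05 files the record-level
SP END, re-dock D4∕D6 by one lemma name»), executed on leaf lineage `…-leaf-05` gen 47's `NE9FutureProfileEndOfRecordSP` (p256694 ✓,
§3 `ne9_and_fadingMemory_of_holoSlice_sharp_SP`): the three record-shape ENDs of `NE9HoloFamilyVacuumSubtracted` (D6, p255851 ✓) are
REPEATED with the ONE name swap `NE9FutureProfileEndOfRecordSharp.ne9_and_fadingMemory_of_holoSlice_sharp ↦
NE9FutureProfileEndOfRecordSP.ne9_and_fadingMemory_of_holoSlice_sharp_SP`; every hypothesis list is BYTE-IDENTICAL to D6's, only the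
conclusion letters change (`2 / (1 - θ) ↦ 1 / (1 - θ ^ 2)`, `2 * θ / (1 + θ) ↦ θ`).  D4∕D6 stay as landed (append-only rule; their
Earle–Hamilton ENDs remain correct theorems); this file is their SP sibling.

HONEST FRAMING (T4-DAG PAGE 1).  Rung (B)+1 of the FINITE-VOLUME T⁴ programme — NOT infinite volume, NOT a mass gap, NOT Clay.  NE9
(`T4OutputRate.NE9` ∧ `FadingMemory`) is a cell NEW ESTIMATE, NOT PRINTED in [I] = [Balaban1987RG1] (CMP **109**), [II] =
[Balaban1988RG2Cluster] (CMP **116**), NOT PROVED for Bałaban's E^{(j)}: every theorem below is «NE9 ⇐ the named binders»; the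
displayed Bałaban-side inputs are UNCHANGED from D6 — the pencil END's (`hhol`∕`hsup` = (R-0)[scope] «[II] Lemma 3 (2.38) read over
Lemma 2's box» on the radius `R₀` at every background incl. `U₀`, `hkp2`, `hdec`, `hpin`), the explicit part's size letter `hexplZ`
(TYPE [I] (2.14) p. 268 ∕ [II] (2.41) p. 21), the coupling half `hlast` (displayed; dischargeable BY NAME from the coupling two-point
letters via `NE9VacuumSubtractedBridge` §2 — leaf-06's PART C), the structural binders, the ℝ-closure of `Adm`, base-free runs, the
ROOM `ω̂·s₀ + τ̄·(2B + p̄₀) ≤ θ·s₀`; W1 = model O-NE9-1 untouched; spine 0∕9.  HONEST DEPENDENCY (cell line, verbatim): continuum YM on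
T⁴ ⇐ BetaPertH ∧ nine spine estimates (0/9 proved); BetaPertH ⇐ (D1) ∧ (D4) ∧ CAP+tail; G-an2-4 gates asym, D1 and NE2/3/4.
`FlowStep.BetaPertH`, (B), (B^μ) do not occur; [I]∕[II] for TYPES only (ABSOLUTE RULE).  A sharper RATE inside a CONDITIONAL END is
not progress on the estimate itself; in the refuter's letters (PRICING-NE9 v8 §B (B8-3)) R4's rate at the record becomes
`θ = ω̂ + (1−ω̂)∕S` itself, LIFE REGION (S > 1) UNCHANGED.
CONTENT ([folklore]; 0 def, 0 sorry): §1 **`ne9_and_fadingMemory_of_holoFamily_SP`** (D6 §1 ∕ D4's family END re-docked: structural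
binders + conjugation `σ` + per-coordinate (c-holo)∕(c-size) `B₁`∕(c-real), room `ω̂·r + τ̄·B₁ ≤ θ·r` ⊢ SP moduli);
§2 **`ne9_and_fadingMemory_of_pencil_SP_vac`** (abstract conjugation) and **`…_SP_vac_star`** (Mathlib's `star`): D6 §2's hypotheses
VERBATIM (pencil data + the record's SHAPE `hΨv` + `hexplZ` + room `ω̂·s₀ + τ̄·(2B + p̄₀) ≤ θ·s₀`) ⊢ `NE9 ∧ FadingMemory` with
`prodModuli ((1∕(1−θ²))·ℓ) (fun _ => θ)`; §3 **`ne9_and_fadingMemory_of_psiOf_star_SP`** (the END at `Ψ := NE9EndApplied.ΨOf G act wt U₀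
explZ`, `hΨv` discharged by D6's `psiOf_eq_vac`, `rfl`); §4 arithmetic `example` (the two moduli pairs at the print-letter reading
θ = 15∕26, asserted of nothing).  DISGUISE TEST: composition by name; nothing of Bałaban's asserted.  References (TYPES only):
[Balaban1987RG1] CMP **109** (2.13)–(2.14) p. 268, (0.23) p. 256; [Balaban1988RG2Cluster] CMP **116** (2.13)–(2.15) pp. 14–15, Lemma 3
(2.38) p. 20, (2.40)–(2.41) p. 21, (1.36) p. 9; [KoteckyPreiss1986] pp. 492–493; [FV1980] ch. V §5 (polydisc Schwarz–Pick).
Summits-side NEW work (LEAN PLACEMENT RULE); imports D6 and leaf-05's p256694 BY NAME; modifies nothing; 0 sorry.  Value = the three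
record-shape ENDs of route R4 at the SP rate, NOT summit progress.
-/

noncomputable section

namespace Summit.QuantumFields.BalabanUV.T4Continuum.NE9HoloFamilyVacuumSubtractedSP

open Metric Set ComplexConjugate
open scoped BigOperators ENNReal
open Literature.Probability.LatticeModels
open Literature.MathematicalPhysics.QuantumFieldTheory.Balaban1983to89
open Literature.MathematicalPhysics.QuantumFieldTheory.Balaban1983to89.T4OutputRate
open Literature.MathematicalPhysics.QuantumFieldTheory.Balaban1983to89.T4ActivityLipschitz
open Literature.MathematicalPhysics.QuantumFieldTheory.Balaban1983to89.T4HistoryLipschitzRecursion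
open Literature.MathematicalPhysics.QuantumFieldTheory.Balaban1983to89.T4HistoryLipschitzOuter
open Literature.MathematicalPhysics.QuantumFieldTheory.Balaban1983to89.T4HistoryLipschitzActivity
open Literature.MathematicalPhysics.QuantumFieldTheory.Balaban1983to89.T4HistoryLipschitzSegment
open Literature.MathematicalPhysics.QuantumFieldTheory.Balaban1983to89.T4HistoryLipschitzActivity (ClusterGeom)
open Summit.QuantumFields.BalabanUV.T4Continuum.NE9TableReading
open Summit.QuantumFields.BalabanUV.T4Continuum.NE9TwoPointKPOfPencil
open Summit.QuantumFields.BalabanUV.T4Continuum.NE9FutureProfileRecordPrelim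
open Summit.QuantumFields.BalabanUV.T4Continuum.NE9HoloSliceOfFamily
open Summit.QuantumFields.BalabanUV.T4Continuum.NE9HoloFamilyOfPencil
open Summit.QuantumFields.BalabanUV.T4Continuum.NE9FutureProfileReal
open Summit.QuantumFields.BalabanUV.T4Continuum.NE9FutureProfileEndOfRecordSP
open Summit.QuantumFields.BalabanUV.T4Continuum.NE9HoloFamilyVacuumSubtracted (psiOf_eq_vac)

variable {C : Carriers} (G : ClusterGeom C) {Bg : Type}

section End

variable {ι : Type} [Nonempty ι] {E : Functional C Bg} {W : Set (ℕ → ℝ)} {Adm : Set (Bg → C.Dom → ℝ)}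
  {T : ℕ → (ℕ → ℝ) → (Bg → C.Dom → ℝ) → ι → ℝ} {Ψ : ℕ → ℝ → (ι → ℝ) → Bg → C.Dom → ℝ}
  {κ : ℝ} {wt : ℕ → ι → ℝ} {τ : ℕ → ℕ → ℝ} {τbar ω ωh : ℝ}

/-! ## §1 The family END re-docked at the ♯-END of record (D4 ∕ D6 §1 at the Schwarz–Pick rate) -/

omit G in
/-- **ROUTE R4♯'s END AT THE RECORD FROM A COMPLEX FAMILY MAP, ROOM `ω̂·r + τ̄·B₁ ≤ θ·r`, SHARP RATE** — the hypotheses of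
`NE9HoloFamilyVacuumSubtracted.ne9_and_fadingMemory_of_holoFamily_sharp` VERBATIM and in the same order (structural binders +
conjugation `σ` + per-coordinate (c-holo)∕(c-size) `B₁`∕(c-real) + room) ⊢ `NE9 E W κ (prodModuli ((1∕(1−θ²))·ℓ) (fun _ => θ)) ∧
FadingMemory …`: the owner's `holoSlice` construction (`NE9HoloSliceOfFamily`) fed to leaf-05's ♯-END
`NE9FutureProfileEndOfRecordSP.ne9_and_fadingMemory_of_holoSlice_sharp_SP` instead of the Earle–Hamilton END (one name swap).
«NE9 ⇐ the named binders». [cite: Balaban1988RG2Cluster, (2.13)-(2.15) pp.14-15 and (1.36) p.9] -/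
theorem ne9_and_fadingMemory_of_holoFamily_SP
    (h0 : ∀ g ∈ W, ∀ (U : Bg) (X : C.Dom), C.scale X = 0 → E g U X = 0)
    (hAdm : AdmissibleTerms E W Adm) (hres : AdmRestrict Adm) (hadd : ChannelAdditive Adm T) (hloc : ChannelLocal Adm T)
    (hstep : ChannelSizeAtStepNN Adm T κ wt τ) (hfac : Factorises E W T Ψ) {lam : ℕ → ℝ}
    (hlast : LastCouplingLipschitz E W T Ψ κ lam)
    (hsmul : ∀ (c : ℝ), ∀ H ∈ Adm, c • H ∈ Adm) (hne : Adm.Nonempty) (hwt : ∀ m y, 0 < wt m y)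
    (hτ : ∀ k j, j ≤ k → 0 ≤ τ k j ∧ τ k j ≤ τbar * ω ^ (k - j)) (hτbar : 0 < τbar) (hω : 0 ≤ ω) (hωh : 0 < ωh)
    (hωωh : ω ≤ ωh) {σ : lp (fun _ : ι => ℂ) ∞ →L[ℝ] lp (fun _ : ι => ℂ) ∞}
    (hσ : ∀ (c : ℂ) (x : lp (fun _ : ι => ℂ) ∞), σ (c • x) = conj c • σ x) (hiso : ∀ x, ‖σ x‖ = ‖x‖)
    (hfixρ : ∀ (k : ℕ) (P : ι → ℝ), σ (reading (wt k) P) = reading (wt k) P)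
    {Φc : ℕ → ℝ → lp (fun _ : ι => ℂ) ∞ → Bg → C.Dom → ℂ} {r B₁ θ ℓ : ℝ} (hr : 0 < r) (hB₁ : 0 ≤ B₁) (hθ0 : 0 < θ)
    (hθ1 : θ < 1) (hℓ : 0 ≤ ℓ)
    (hcd : ∀ k, ∀ g ∈ W, ∀ (U : Bg) (X : C.Dom), C.scale X = k + 1 →
      DifferentiableOn ℂ (fun Q => Φc k (g k) Q U X) (ball 0 r))
    (hcb : ∀ k, ∀ g ∈ W, ∀ (U : Bg) (X : C.Dom), C.scale X = k + 1 →
      ∀ Q ∈ ball (0 : lp (fun _ : ι => ℂ) ∞) r, ‖Φc k (g k) Q U X‖ ≤ Real.exp (-(κ * C.d X)) * B₁)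
    (hcre : ∀ k, ∀ g ∈ W, ∀ s ∈ W, ∀ (U : Bg) (X : C.Dom), C.scale X = k + 1 →
      Ψ k (s k) (T k s (E g)) U X = (Φc k (s k) (reading (wt k) (T k s (E g))) U X).re)
    (hroom : ωh * r + τbar * B₁ ≤ θ * r) (hlam : ∀ k, lam k ≤ ℓ) :
    NE9 E W κ (prodModuli (1 / (1 - θ ^ 2) * ℓ) fun _ => θ) ∧
      FadingMemory (1 / (1 - θ ^ 2) * ℓ / θ) θ (prodModuli (1 / (1 - θ ^ 2) * ℓ) fun _ => θ) :=
  ne9_and_fadingMemory_of_holoSlice_sharp_SP h0 hAdm hres hadd hloc hstep hfac hlast hsmul hne hwt hτ hτbar hω hωh hωωh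
    (ΦY := holoSlice κ σ Φc) hr hB₁ hθ0 hθ1 hℓ
    (fun k g hg => holoSlice_differentiableOn hσ hiso hB₁ (hcd k g hg) (hcb k g hg))
    (fun k g hg => holoSlice_mapsTo hσ hiso hB₁ (hcd k g hg) (hcb k g hg))
    (holoSlice_real hσ hiso hfixρ hB₁ hcd hcb hcre) hroom hlam

/-! ## §2 THE ♯-END OF ROUTE R4 ON THE VACUUM-SUBTRACTED SLICE (D6 §2 at the Schwarz–Pick rate) -/

/-- **ROUTE R4♯'s END OF RECORD ON THE RECORD's NEW-TERM SHAPE (vacuum-subtracted slice; abstract conjugation), SHARP RATE.**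
Hypotheses = `NE9HoloFamilyVacuumSubtracted.ne9_and_fadingMemory_of_pencil_EH_vac`'s VERBATIM and in the same order: the END of
record's structural binders; the PENCIL DATA (`hhol` line-holomorphy of every activity on `‖Q‖ < R₀` at EVERY background — in
particular at the vacuum configuration `U₀` —, `hsup` the majorant on that ball, `hkp2`, `hdec`, `hpin` with budget `B`); the
record's SHAPE `hΨv` («new term = Re of the cluster sum at `U` minus Re of the cluster sum at `U₀` plus the coupling-free explicit
part», [I] (2.13)–(2.14); `NE9EndApplied.ΨOf` by `rfl`, §3) and the explicit part's size letter `hexplZ` (`p₀ k ≤ p̄₀`); the admissible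
class closed under real scalars, a conjugation `σ` fixing the weighted readings of real tables, and the ROOM `ω̂·s₀ + τ̄·(2B + p̄₀) ≤
θ·s₀` on an inner radius `0 < s₀ < R₀`, `0 < θ < 1`, `ω ≤ ω̂`.  Conclusion: `NE9 E W κ (prodModuli ((1∕(1−θ²))·ℓ) (fun _ => θ)) ∧
FadingMemory …` (D6 reads `2∕(1−θ)`, `2θ∕(1+θ)`).  Proof = D6 §2's with §1 in place of `…_holoFamily_sharp`: the slice
`Φc := newTerm_U Q − newTerm_{U₀} Q + explZ` has (c-holo) by `differentiableOn_newTerm` twice, (c-size) `2B + p̄₀` by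
`norm_newTerm_le_of_pencil` twice + the letter, (c-real) EXACT.  «NE9 ⇐ the named binders».
[cite: Balaban1987RG1, (2.13)-(2.14) p.268; Balaban1988RG2Cluster, Lemma 3 (2.38) p.20 and (2.40)-(2.41) p.21; FV1980, ch.V §5] -/
theorem ne9_and_fadingMemory_of_pencil_SP_vac
    (h0 : ∀ g ∈ W, ∀ (U : Bg) (X : C.Dom), C.scale X = 0 → E g U X = 0)
    (hAdm : AdmissibleTerms E W Adm) (hres : AdmRestrict Adm) (hadd : ChannelAdditive Adm T) (hloc : ChannelLocal Adm T)
    (hstep : ChannelSizeAtStepNN Adm T κ wt τ) (hfac : Factorises E W T Ψ) {lam : ℕ → ℝ}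
    (hlast : LastCouplingLipschitz E W T Ψ κ lam)
    (hsmul : ∀ (c : ℝ), ∀ H ∈ Adm, c • H ∈ Adm) (hne : Adm.Nonempty) (hwt : ∀ m y, 0 < wt m y)
    (hτ : ∀ k j, j ≤ k → 0 ≤ τ k j ∧ τ k j ≤ τbar * ω ^ (k - j)) (hτbar : 0 < τbar) (hω : 0 ≤ ω) (hωh : 0 < ωh)
    (hωωh : ω ≤ ωh) {σ : lp (fun _ : ι => ℂ) ∞ →L[ℝ] lp (fun _ : ι => ℂ) ∞}
    (hσ : ∀ (c : ℂ) (x : lp (fun _ : ι => ℂ) ∞), σ (c • x) = conj c • σ x) (hiso : ∀ x, ‖σ x‖ = ‖x‖)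
    (hfixρ : ∀ (k : ℕ) (P : ι → ℝ), σ (reading (wt k) P) = reading (wt k) P)
    {act : ℕ → ℝ → Bg → lp (fun _ : ι => ℂ) ∞ → G.P → ℂ} {m : ℕ → ℝ → Bg → G.P → ℝ} {a d : G.P → ℝ}
    {δ : C.Dom → ℝ} {U₀ : Bg} {explZ : ℕ → Bg → C.Dom → ℝ} {p₀ : ℕ → ℝ} {R₀ s₀ B pbar θ ℓ : ℝ}
    (ha : ∀ γ, 0 ≤ a γ) (hd : ∀ γ, 0 ≤ d γ) (hs₀ : 0 < s₀) (hsR : s₀ < R₀)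
    (hB : 0 ≤ B) (hpbar : 0 ≤ pbar) (hθ0 : 0 < θ) (hθ1 : θ < 1) (hℓ : 0 ≤ ℓ)
    (hhol : ∀ g ∈ W, ∀ (k : ℕ) (U : Bg) (X : C.Dom), C.scale X = k + 1 →
      ∀ γ ∈ G.vol X, LineHolo (fun Q => act k (g k) U Q γ) R₀)
    (hsup : ∀ g ∈ W, ∀ (k : ℕ) (U : Bg) (X : C.Dom), C.scale X = k + 1 →
      ∀ Q ∈ ball (0 : lp (fun _ : ι => ℂ) ∞) R₀, ∀ γ ∈ G.vol X, ‖act k (g k) U Q γ‖ ≤ m k (g k) U γ)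
    (hkp2 : ∀ g ∈ W, ∀ (k : ℕ) (U : Bg) (X : C.Dom), C.scale X = k + 1 →
      ∀ γ ∈ G.vol X, ∑ γ' ∈ G.vol X with G.inc γ' γ, 2 * m k (g k) U γ' * Real.exp (a γ' + d γ') ≤ a γ)
    (hdec : G.DecayExtract δ d) (hpin : G.PinBudget a δ (fun _ => B) κ)
    (hΨv : ∀ (k : ℕ) (s : ℝ) (P : ι → ℝ) (U : Bg) (X : C.Dom),
      Ψ k s P U X = (G.newTerm act k s U X (reading (wt k) P)).re - (G.newTerm act k s U₀ X (reading (wt k) P)).re +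
        explZ k U X)
    (hexplZ : ∀ (k : ℕ) (U : Bg) (X : C.Dom), C.scale X = k + 1 → |explZ k U X| ≤ Real.exp (-(κ * C.d X)) * p₀ k)
    (hp₀ : ∀ k, p₀ k ≤ pbar)
    (hroom : ωh * s₀ + τbar * (2 * B + pbar) ≤ θ * s₀) (hlam : ∀ k, lam k ≤ ℓ) :
    NE9 E W κ (prodModuli (1 / (1 - θ ^ 2) * ℓ) fun _ => θ) ∧
      FadingMemory (1 / (1 - θ ^ 2) * ℓ / θ) θ (prodModuli (1 / (1 - θ ^ 2) * ℓ) fun _ => θ) := by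
  -- the complex family map: the VACUUM-SUBTRACTED cluster sum plus the (real, table-free) explicit part
  let Φc : ℕ → ℝ → lp (fun _ : ι => ℂ) ∞ → Bg → C.Dom → ℂ := fun k s Q U X =>
    G.newTerm act k s U X Q - G.newTerm act k s U₀ X Q + ((explZ k U X : ℝ) : ℂ)
  have hball : ball (0 : lp (fun _ : ι => ℂ) ∞) s₀ ⊆ ball 0 R₀ := ball_subset_ball hsR.le
  have hball' : ball (0 : lp (fun _ : ι => ℂ) ∞) s₀ ⊆ closedBall 0 s₀ := ball_subset_closedBall
  refine ne9_and_fadingMemory_of_holoFamily_SP h0 hAdm hres hadd hloc hstep hfac hlast hsmul hne hwt hτ hτbar hω hωh hωωh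
    hσ hiso hfixρ (Φc := Φc) (r := s₀) (B₁ := 2 * B + pbar) hs₀ (by positivity) hθ0 hθ1 hℓ ?_ ?_ ?_ hroom hlam
  · -- (c-holo): two Fréchet-holomorphic cluster sums and a constant
    intro k g hg U X hX
    exact (((differentiableOn_newTerm G hd (hhol g hg k U X hX) (hsup g hg k U X hX) (hkp2 g hg k U X hX)).mono
      hball).sub ((differentiableOn_newTerm G hd (hhol g hg k U₀ X hX) (hsup g hg k U₀ X hX)
        (hkp2 g hg k U₀ X hX)).mono hball)).add (differentiableOn_const _)
  · -- (c-size): pin budget twice + the explicit part's letter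
    intro k g hg U X hX Q hQ
    have h1 := norm_newTerm_le_of_pencil G ha hd hsR hhol hsup hkp2 hdec hpin hg (U := U) hX (hball' hQ)
    have h2 := norm_newTerm_le_of_pencil G ha hd hsR hhol hsup hkp2 hdec hpin hg (U := U₀) hX (hball' hQ)
    have h3 := (hexplZ k U X hX).trans (mul_le_mul_of_nonneg_left (hp₀ k) (Real.exp_pos _).le)
    calc ‖Φc k (g k) Q U X‖
        ≤ ‖G.newTerm act k (g k) U X Q‖ + ‖G.newTerm act k (g k) U₀ X Q‖ + ‖((explZ k U X : ℝ) : ℂ)‖ :=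
          (norm_add_le _ _).trans (add_le_add (norm_sub_le _ _) le_rfl)
      _ ≤ B * Real.exp (-(κ * C.d X)) + B * Real.exp (-(κ * C.d X)) + Real.exp (-(κ * C.d X)) * pbar := by
          refine add_le_add (add_le_add h1 h2) ?_
          rw [Complex.norm_real, Real.norm_eq_abs]
          exact h3
      _ = Real.exp (-(κ * C.d X)) * (2 * B + pbar) := by ring
  · -- (c-real): EXACT — the record's new term IS the real part of the vacuum-subtracted slice at the record's tables
    intro k g _ s _ U X _
    rw [hΨv]
    simp only [Φc, Complex.add_re, Complex.sub_re, Complex.ofReal_re]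

/-- **ROUTE R4♯'s END OF RECORD ON THE RECORD's NEW-TERM SHAPE — `star` INSTANTIATED, SHARP RATE.**  Displayed inputs = the pencil
END's structural binders and pencil data (`hhol`, `hsup`, `hkp2`, `hdec`, `hpin`) + base-free runs `h0` + `Adm` closed under real
scalars + the record's SHAPE `hΨv` + the letter `hexplZ` (`p₀ k ≤ p̄₀`) + the coupling half `hlast` + the ROOM `ω̂·s₀ + τ̄·(2B + p̄₀) ≤
θ·s₀` (`0 < s₀ < R₀`) — VERBATIM `NE9HoloFamilyVacuumSubtracted.ne9_and_fadingMemory_of_pencil_EH_vac_star`'s.  Conclusion: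
`NE9 ∧ FadingMemory` with `prodModuli ((1∕(1−θ²))·ℓ) (fun _ => θ)`.  «NE9 ⇐ the named binders».
[cite: Balaban1987RG1, (2.13)-(2.14) p.268; Balaban1988RG2Cluster, Lemma 3 (2.38) p.20 and (2.40)-(2.41) p.21; FV1980, ch.V §5] -/
theorem ne9_and_fadingMemory_of_pencil_SP_vac_star
    (h0 : ∀ g ∈ W, ∀ (U : Bg) (X : C.Dom), C.scale X = 0 → E g U X = 0)
    (hAdm : AdmissibleTerms E W Adm) (hres : AdmRestrict Adm) (hadd : ChannelAdditive Adm T) (hloc : ChannelLocal Adm T)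
    (hstep : ChannelSizeAtStepNN Adm T κ wt τ) (hfac : Factorises E W T Ψ) {lam : ℕ → ℝ}
    (hlast : LastCouplingLipschitz E W T Ψ κ lam)
    (hsmul : ∀ (c : ℝ), ∀ H ∈ Adm, c • H ∈ Adm) (hne : Adm.Nonempty) (hwt : ∀ m y, 0 < wt m y)
    (hτ : ∀ k j, j ≤ k → 0 ≤ τ k j ∧ τ k j ≤ τbar * ω ^ (k - j)) (hτbar : 0 < τbar) (hω : 0 ≤ ω) (hωh : 0 < ωh)
    (hωωh : ω ≤ ωh)
    {act : ℕ → ℝ → Bg → lp (fun _ : ι => ℂ) ∞ → G.P → ℂ} {m : ℕ → ℝ → Bg → G.P → ℝ} {a d : G.P → ℝ}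
    {δ : C.Dom → ℝ} {U₀ : Bg} {explZ : ℕ → Bg → C.Dom → ℝ} {p₀ : ℕ → ℝ} {R₀ s₀ B pbar θ ℓ : ℝ}
    (ha : ∀ γ, 0 ≤ a γ) (hd : ∀ γ, 0 ≤ d γ) (hs₀ : 0 < s₀) (hsR : s₀ < R₀)
    (hB : 0 ≤ B) (hpbar : 0 ≤ pbar) (hθ0 : 0 < θ) (hθ1 : θ < 1) (hℓ : 0 ≤ ℓ)
    (hhol : ∀ g ∈ W, ∀ (k : ℕ) (U : Bg) (X : C.Dom), C.scale X = k + 1 →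
      ∀ γ ∈ G.vol X, LineHolo (fun Q => act k (g k) U Q γ) R₀)
    (hsup : ∀ g ∈ W, ∀ (k : ℕ) (U : Bg) (X : C.Dom), C.scale X = k + 1 →
      ∀ Q ∈ ball (0 : lp (fun _ : ι => ℂ) ∞) R₀, ∀ γ ∈ G.vol X, ‖act k (g k) U Q γ‖ ≤ m k (g k) U γ)
    (hkp2 : ∀ g ∈ W, ∀ (k : ℕ) (U : Bg) (X : C.Dom), C.scale X = k + 1 →
      ∀ γ ∈ G.vol X, ∑ γ' ∈ G.vol X with G.inc γ' γ, 2 * m k (g k) U γ' * Real.exp (a γ' + d γ') ≤ a γ)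
    (hdec : G.DecayExtract δ d) (hpin : G.PinBudget a δ (fun _ => B) κ)
    (hΨv : ∀ (k : ℕ) (s : ℝ) (P : ι → ℝ) (U : Bg) (X : C.Dom),
      Ψ k s P U X = (G.newTerm act k s U X (reading (wt k) P)).re - (G.newTerm act k s U₀ X (reading (wt k) P)).re +
        explZ k U X)
    (hexplZ : ∀ (k : ℕ) (U : Bg) (X : C.Dom), C.scale X = k + 1 → |explZ k U X| ≤ Real.exp (-(κ * C.d X)) * p₀ k)
    (hp₀ : ∀ k, p₀ k ≤ pbar)
    (hroom : ωh * s₀ + τbar * (2 * B + pbar) ≤ θ * s₀) (hlam : ∀ k, lam k ≤ ℓ) :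
    NE9 E W κ (prodModuli (1 / (1 - θ ^ 2) * ℓ) fun _ => θ) ∧
      FadingMemory (1 / (1 - θ ^ 2) * ℓ / θ) θ (prodModuli (1 / (1 - θ ^ 2) * ℓ) fun _ => θ) := by
  obtain ⟨σ, hσa, hσ, hiso⟩ := exists_star_clm_lp (ι := ι)
  exact ne9_and_fadingMemory_of_pencil_SP_vac G h0 hAdm hres hadd hloc hstep hfac hlast hsmul hne hwt hτ hτbar hω hωh hωωh hσ
    hiso (fun k P => by rw [hσa]; exact (isSelfAdjoint_reading (wt k) P).star_eq) ha hd hs₀ hsR hB hpbar hθ0 hθ1 hℓ hhol hsup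
    hkp2 hdec hpin hΨv hexplZ hp₀ hroom hlam

end End

/-! ## §3 The ♯-END at the record's own new-term map `NE9EndApplied.ΨOf` (shape discharged by `rfl`) -/

section Record

open Summit.QuantumFields.BalabanUV.T4Continuum.NE9EndApplied
open Summit.QuantumFields.BalabanUV.T4Continuum.NE9ComplexEncoding (doubleCarriers)

variable {C₀ : Carriers} {E : Type} {ι : Type}

omit G in
/-- **ROUTE R4♯'s END AT THE RECORD's OWN NEW-TERM MAP `ΨOf`, SHARP RATE** — `ne9_and_fadingMemory_of_pencil_SP_vac_star` at
`Ψ := NE9EndApplied.ΨOf G act wt U₀ explZ` (the shape hypothesis discharged by `NE9HoloFamilyVacuumSubtracted.psiOf_eq_vac`, `rfl`):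
for ANY functional `Ef` on the re∕im-doubled carriers factorising through a channel `T` with this new-term map (e.g. the defined
functional `EfOf …`, `NE9EndApplied.factorises_EfOf`), the pencil data + `hexplZ` + structural binders + `hlast` + the ROOM
`ω̂·s₀ + τ̄·(2B + p̄₀) ≤ θ·s₀` ⇒ `NE9 Ef W κ (prodModuli ((1∕(1−θ²))·ℓ) (fun _ => θ)) ∧ FadingMemory …` — hypotheses VERBATIM
`NE9HoloFamilyVacuumSubtracted.ne9_and_fadingMemory_of_psiOf_star`'s.  In the refuter's letters (PRICING-NE9 v8 §H T8‴): the SP-END of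
record at the record's own shape.  «NE9 ⇐ the named binders»; nothing of Bałaban's asserted.
[cite: Balaban1987RG1, (2.13)-(2.14) p.268 and (0.23) p.256; Balaban1988RG2Cluster, Lemma 3 (2.38) p.20 and (2.40)-(2.41) p.21; FV1980, ch.V §5] -/
theorem ne9_and_fadingMemory_of_psiOf_star_SP [Nonempty ι] (G : ClusterGeom (doubleCarriers C₀))
    {Ef : Functional (doubleCarriers C₀) E} {W : Set (ℕ → ℝ)} {Adm : Set (E → (doubleCarriers C₀).Dom → ℝ)}
    {T : ℕ → (ℕ → ℝ) → (E → (doubleCarriers C₀).Dom → ℝ) → ι → ℝ} {κ : ℝ} {wt : ℕ → ι → ℝ} {τ : ℕ → ℕ → ℝ}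
    {τbar ω ωh : ℝ} {act : ℕ → ℝ → E → lp (fun _ : ι => ℂ) ∞ → G.P → ℂ} {U₀ : E}
    {explZ : ℕ → E → (doubleCarriers C₀).Dom → ℝ}
    (h0 : ∀ g ∈ W, ∀ (U : E) (X : (doubleCarriers C₀).Dom), (doubleCarriers C₀).scale X = 0 → Ef g U X = 0)
    (hAdm : AdmissibleTerms Ef W Adm) (hres : AdmRestrict Adm) (hadd : ChannelAdditive Adm T) (hloc : ChannelLocal Adm T)
    (hstep : ChannelSizeAtStepNN Adm T κ wt τ) (hfac : Factorises Ef W T (ΨOf G act wt U₀ explZ)) {lam : ℕ → ℝ}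
    (hlast : LastCouplingLipschitz Ef W T (ΨOf G act wt U₀ explZ) κ lam)
    (hsmul : ∀ (c : ℝ), ∀ H ∈ Adm, c • H ∈ Adm) (hne : Adm.Nonempty) (hwt : ∀ m y, 0 < wt m y)
    (hτ : ∀ k j, j ≤ k → 0 ≤ τ k j ∧ τ k j ≤ τbar * ω ^ (k - j)) (hτbar : 0 < τbar) (hω : 0 ≤ ω) (hωh : 0 < ωh)
    (hωωh : ω ≤ ωh) {m : ℕ → ℝ → E → G.P → ℝ} {a d : G.P → ℝ} {δ : (doubleCarriers C₀).Dom → ℝ} {p₀ : ℕ → ℝ}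
    {R₀ s₀ B pbar θ ℓ : ℝ} (ha : ∀ γ, 0 ≤ a γ) (hd : ∀ γ, 0 ≤ d γ) (hs₀ : 0 < s₀) (hsR : s₀ < R₀)
    (hB : 0 ≤ B) (hpbar : 0 ≤ pbar) (hθ0 : 0 < θ) (hθ1 : θ < 1) (hℓ : 0 ≤ ℓ)
    (hhol : ∀ g ∈ W, ∀ (k : ℕ) (U : E) (X : (doubleCarriers C₀).Dom), (doubleCarriers C₀).scale X = k + 1 →
      ∀ γ ∈ G.vol X, LineHolo (fun Q => act k (g k) U Q γ) R₀)
    (hsup : ∀ g ∈ W, ∀ (k : ℕ) (U : E) (X : (doubleCarriers C₀).Dom), (doubleCarriers C₀).scale X = k + 1 →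
      ∀ Q ∈ ball (0 : lp (fun _ : ι => ℂ) ∞) R₀, ∀ γ ∈ G.vol X, ‖act k (g k) U Q γ‖ ≤ m k (g k) U γ)
    (hkp2 : ∀ g ∈ W, ∀ (k : ℕ) (U : E) (X : (doubleCarriers C₀).Dom), (doubleCarriers C₀).scale X = k + 1 →
      ∀ γ ∈ G.vol X, ∑ γ' ∈ G.vol X with G.inc γ' γ, 2 * m k (g k) U γ' * Real.exp (a γ' + d γ') ≤ a γ)
    (hdec : G.DecayExtract δ d) (hpin : G.PinBudget a δ (fun _ => B) κ)
    (hexplZ : ∀ (k : ℕ) (U : E) (X : (doubleCarriers C₀).Dom), (doubleCarriers C₀).scale X = k + 1 →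
      |explZ k U X| ≤ Real.exp (-(κ * (doubleCarriers C₀).d X)) * p₀ k)
    (hp₀ : ∀ k, p₀ k ≤ pbar)
    (hroom : ωh * s₀ + τbar * (2 * B + pbar) ≤ θ * s₀) (hlam : ∀ k, lam k ≤ ℓ) :
    NE9 Ef W κ (prodModuli (1 / (1 - θ ^ 2) * ℓ) fun _ => θ) ∧
      FadingMemory (1 / (1 - θ ^ 2) * ℓ / θ) θ (prodModuli (1 / (1 - θ ^ 2) * ℓ) fun _ => θ) :=
  ne9_and_fadingMemory_of_pencil_SP_vac_star G h0 hAdm hres hadd hloc hstep hfac hlast hsmul hne hwt hτ hτbar hω hωh hωωh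
    ha hd hs₀ hsR hB hpbar hθ0 hθ1 hℓ hhol hsup hkp2 hdec hpin (fun k s Q U X => psiOf_eq_vac G act wt U₀ explZ k s Q U X)
    hexplZ hp₀ hroom hlam

end Record

/-! ## §4 Arithmetic at the room's print-letter reading (asserted of nothing) -/

/-- ARITHMETIC AT THE ROOM's print-letter READING (PRICING-NE9 v8 §B (B8-3) ∕ §C′: box slack `S`, `ω̂`, `θ = ω̂ + (1 − ω̂)∕S`;
at `S = 24∕13`, `ω̂ = 1∕13`: `θ = 15∕26`): the record-shape END's moduli move from D6's `(52∕11)·ℓ` at rate `30∕41` to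
`(676∕451)·ℓ` at rate `15∕26`; and for every `0 < θ < 1` the SP pair is below the EH pair (`θ < 2θ∕(1+θ)`,
`1∕(1−θ²) < 2∕(1−θ)`).  A READING, asserted of nothing. [folklore] -/
example : (1 : ℝ) / (1 - (15 / 26) ^ 2) = 676 / 451 ∧ (2 : ℝ) / (1 - 15 / 26) = 52 / 11 ∧
    (∀ θ : ℝ, 0 < θ → θ < 1 → θ < 2 * θ / (1 + θ) ∧ 1 / (1 - θ ^ 2) < 2 / (1 - θ)) := by
  refine ⟨by norm_num, by norm_num, fun θ h0 h1 => ⟨?_, ?_⟩⟩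
  · rw [lt_div_iff₀ (by linarith)]; nlinarith
  · have h2 : 0 < 1 - θ ^ 2 := by nlinarith
    have h3 : 0 < 1 - θ := by linarith
    rw [div_lt_div_iff₀ h2 h3]; nlinarith

end Summit.QuantumFields.BalabanUV.T4Continuum.NE9HoloFamilyVacuumSubtractedSP

end
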